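import Summits.QuantumFields.YangMills.Theorems.LuscherReductionTwistedTraceScalingGaugeActionCovariant
import Literature.MathematicalPhysics.QuantumFieldTheory.Balaban1983to89.T4WilsonLinkAffine
import Mathlib.Analysis.Calculus.ContDiff.WithLp
import Mathlib.Analysis.SpecialFunctions.Sqrt
import HarnessLib

/-!
# The relative coordinate of a gauge-transformed tube point is a SMOOTH function of (gauge parameter, stiff coordinate, slow coordinate) near `0`
# (lane A of S-BASE, crux `TwistedTraceScaling` stmt-QuantumFields-20203, C4 INNER; design note `pub/ym-fleet/ym-luscher-20007-p1/COARSE-DESIGN.md` §23.8 (N1)(a))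

The inverse-function step of (N1) (`…SliceImplicit`, abstract; `…SliceEquiv`, the invertible block) needs the map
`Φ̂ : z = (ξ, (w, c)) ↦ relLinkVec((orthoTube P(c) w)^{P∘ξ})` (tree name `actCfg`; `P = chartSU2`) to be strictly differentiable at `0`.  THIS FILE proves it is `C^n` for every `n`
at `0` (★★ `contDiffAt_relLinkVec_actCfg`, ★★ `hasStrictFDerivAt_relLinkVec_actCfg`) by exhibiting, near `0`, an explicitly smooth QUATERNION MODEL (★ `relLinkVec_actCfg_eventuallyEq`):
`su2Quat((U^h)_e · p_k(U^h)⁻¹) = ‖M_k‖⁻¹ • (Q(ξ_x)Q(w_e)Q(c_k)Q̄(ξ_y) · M̄_k)`, `Q(v) = (√(1−|v|²), v)` the quaternion of `P(v)` (`su2Quat_chartSU2`), `M_k = Σ_x Q(ξ_x)Q(w_{(x,k)})Q(c_k)Q̄(ξ_{x+k})`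
the direction sum (`dirQuat_eq_sum_su2Quat`, `su2Quat_quatToSU2`: the polar mean has quaternion `M_k/‖M_k‖`), products / conjugation / `√` on positives / `‖·‖⁻¹` away from `0`
being smooth.  Toolkit (reusable): `quatChart`, `contDiffAt_quatChart`, `contDiff_quatStar`, `reL`/`imIL`/`imJL`/`imKL` (coordinates as continuous linear maps).
The derivative itself is identified in the sequel from the quantitative linearisation `…GaugeActionCovariant` (`(ξ', w', c') ↦ w' − ∇ξ'` at `0`).
HONEST FRAMING: finite-dimensional calculus for a stub of a child of the CONDITIONAL reduction route R2b1; no spectral claim; C4 OPEN; not a gap, not Clay.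
-/

set_option autoImplicit false

noncomputable section

open Filter Topology Real
open scoped BigOperators Quaternion
open Literature.MathematicalPhysics.QuantumFieldTheory
open Literature.MathematicalPhysics.QuantumLattice

namespace Summit.QuantumFields.YangMills.Theorems.FemtoTransferGap.TwoLattice.ConstTube

open Summit.QuantumFields.YangMills.Theorems.FemtoTransferGap
open Summit.QuantumFields.YangMills.Theorems.FemtoTransferGap.TwoLattice.Stiff (LinkSpace)
open Literature.MathematicalPhysics.QuantumFieldTheory.Balaban1983to89.T4HaarSU2Translate (su2Quat_quatToSU2)
open Literature.MathematicalPhysics.QuantumFieldTheory.Balaban1983to89.T4WilsonLinkAffine (su2Quat_inv)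

/-! ## §1 Quaternion calculus toolkit -/

section Toolkit

variable {n : WithTop ℕ∞}

/-- The quaternion of the orthographic chart point: `Q(v) = (√(1−|v|²), v₀, v₁, v₂)`. [cite: BrockerTomDieck1985, I (1.10)] -/
def quatChart (v : Fin 3 → ℝ) : ℍ := ⟨√(1 - ∑ a, v a ^ 2), v 0, v 1, v 2⟩

/-- The basis quaternions `i, j, k`. [folklore] -/
def quatI : ℍ := ⟨0, 1, 0, 0⟩
/-- The basis quaternion `j`. [folklore] -/
def quatJ : ℍ := ⟨0, 0, 1, 0⟩
/-- The basis quaternion `k`. [folklore] -/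
def quatK : ℍ := ⟨0, 0, 0, 1⟩

/-- `Q(v)` in the basis `1, i, j, k`. [folklore] -/
theorem quatChart_eq (v : Fin 3 → ℝ) : quatChart v = (√(1 - ∑ a, v a ^ 2)) • (1 : ℍ) + v 0 • quatI + v 1 • quatJ + v 2 • quatK := by
  ext <;> simp [quatChart, quatI, quatJ, quatK]

/-- `v ↦ 1 − |v|²` is smooth. [folklore] -/
theorem contDiff_one_sub_sumSq : ContDiff ℝ n (fun v : Fin 3 → ℝ => 1 - ∑ a, v a ^ 2) :=
  contDiff_const.sub (ContDiff.sum fun a _ => (contDiff_apply ℝ ℝ a).pow 2)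

/-- ★ The quaternion chart is smooth on the open unit ball. [folklore] -/
theorem contDiffAt_quatChart {v : Fin 3 → ℝ} (hv : ∑ a, v a ^ 2 < 1) : ContDiffAt ℝ n quatChart v := by
  have h1 : ContDiffAt ℝ n (fun v : Fin 3 → ℝ => √(1 - ∑ a, v a ^ 2)) v := contDiff_one_sub_sumSq.contDiffAt.sqrt (by linarith)
  have h : ContDiffAt ℝ n (fun v : Fin 3 → ℝ => (√(1 - ∑ a, v a ^ 2)) • (1 : ℍ) + v 0 • quatI + v 1 • quatJ + v 2 • quatK) v :=
    (((h1.smul contDiffAt_const).add ((contDiffAt_apply ℝ ℝ 0 v).smul contDiffAt_const)).add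
      ((contDiffAt_apply ℝ ℝ 1 v).smul contDiffAt_const)).add ((contDiffAt_apply ℝ ℝ 2 v).smul contDiffAt_const)
  exact h.congr_of_eventuallyEq (Filter.Eventually.of_forall fun v => quatChart_eq v)

/-- The real part as a continuous linear map. [folklore] -/
def reL : ℍ →L[ℝ] ℝ := LinearMap.toContinuousLinearMap (QuaternionAlgebra.reₗ (-1 : ℝ) 0 (-1) : ℍ →ₗ[ℝ] ℝ)
/-- The `i`-component as a continuous linear map. [folklore] -/
def imIL : ℍ →L[ℝ] ℝ := LinearMap.toContinuousLinearMap (QuaternionAlgebra.imIₗ (-1 : ℝ) 0 (-1) : ℍ →ₗ[ℝ] ℝ)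
/-- The `j`-component as a continuous linear map. [folklore] -/
def imJL : ℍ →L[ℝ] ℝ := LinearMap.toContinuousLinearMap (QuaternionAlgebra.imJₗ (-1 : ℝ) 0 (-1) : ℍ →ₗ[ℝ] ℝ)
/-- The `k`-component as a continuous linear map. [folklore] -/
def imKL : ℍ →L[ℝ] ℝ := LinearMap.toContinuousLinearMap (QuaternionAlgebra.imKₗ (-1 : ℝ) 0 (-1) : ℍ →ₗ[ℝ] ℝ)

/-- `reL q = q.re`. [folklore] -/
@[simp] theorem reL_apply (q : ℍ) : reL q = q.re := rfl
/-- `imIL q = q.imI`. [folklore] -/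
@[simp] theorem imIL_apply (q : ℍ) : imIL q = q.imI := rfl
/-- `imJL q = q.imJ`. [folklore] -/
@[simp] theorem imJL_apply (q : ℍ) : imJL q = q.imJ := rfl
/-- `imKL q = q.imK`. [folklore] -/
@[simp] theorem imKL_apply (q : ℍ) : imKL q = q.imK := rfl

/-- Conjugation in the basis: `q̄ = 2re(q)·1 − q`. [folklore] -/
theorem star_eq_two_re (q : ℍ) : star q = (2 * q.re) • (1 : ℍ) - q := by
  ext
  · simp; ring
  · simp
  · simp
  · simp

/-- ★ Quaternion conjugation is smooth. [folklore] -/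
theorem contDiff_quatStar : ContDiff ℝ n (fun q : ℍ => star q) := by
  have h : ContDiff ℝ n (fun q : ℍ => (2 * q.re) • (1 : ℍ) - q) :=
    ((contDiff_const.mul (reL.contDiff)).smul contDiff_const).sub contDiff_id
  have hfun : (fun q : ℍ => star q) = fun q => (2 * q.re) • (1 : ℍ) - q := funext star_eq_two_re
  rw [hfun]; exact h

/-- The vector of imaginary components. [folklore] -/
def imVec (q : ℍ) : Fin 3 → ℝ := ![q.imI, q.imJ, q.imK]

/-- `vecPart U = imVec (su2Quat U)`. [folklore] -/
theorem vecPart_eq_imVec (U : SU2) : vecPart U = imVec (su2Quat U) := rfl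

/-- Each imaginary component is smooth. [folklore] -/
theorem contDiff_imVec (a : Fin 3) : ContDiff ℝ n (fun q : ℍ => imVec q a) := by
  fin_cases a
  · exact imIL.contDiff
  · exact imJL.contDiff
  · exact imKL.contDiff

/-- ★ `su2Quat (P(v)) = Q(v)` on the closed unit ball. [cite: BrockerTomDieck1985, I (1.10)] -/
theorem su2Quat_chartSU2 {v : Fin 3 → ℝ} (hv : ∑ a, v a ^ 2 ≤ 1) : su2Quat (chartSU2 v) = quatChart v := by
  have hs := scalarPart_chartSU2 hv
  have hvv := vecPart_chartSU2 hv
  ext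
  · exact hs
  · exact congrFun hvv 0
  · exact congrFun hvv 1
  · exact congrFun hvv 2

/-- `imVec 1 = 0`. [folklore] -/
theorem imVec_one : imVec (1 : ℍ) = 0 := by
  funext a
  fin_cases a <;> simp [imVec]

end Toolkit

variable (L : ℕ) [NeZero L]

/-! ## §2 The direction sum is a sum of quaternions -/

/-- `dirQuat L k U = Σ_x su2Quat (U (x,k))`. [folklore] -/
theorem dirQuat_eq_sum_su2Quat (k : Fin 3) (U : GaugeConfig 3 L SU2) : dirQuat L k U = ∑ x : Site 3 L, su2Quat (U (x, k)) := by
  ext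
  · show dirScalarSum L k U = _
    rw [← reL_apply, map_sum]; rfl
  · show dirVecSum L k U 0 = _
    rw [← imIL_apply, map_sum, dirVecSum, Finset.sum_apply]; rfl
  · show dirVecSum L k U 1 = _
    rw [← imJL_apply, map_sum, dirVecSum, Finset.sum_apply]; rfl
  · show dirVecSum L k U 2 = _
    rw [← imKL_apply, map_sum, dirVecSum, Finset.sum_apply]; rfl

/-! ## §3 The parameter space, the transformed tube point and its quaternion model -/

/-- The parameter space `(ξ, (w, c))`: gauge parameter, stiff coordinate, slow coordinate. [folklore] -/
abbrev SliceParam : Type := (Site 3 L → Fin 3 → ℝ) × ((Edge 3 L → Fin 3 → ℝ) × (Fin 3 → Fin 3 → ℝ))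

/-- The gauge-transformed tube point `(orthoTube P(c) w)^{P∘ξ}`. [folklore] -/
def actCfg (z : SliceParam L) : GaugeConfig 3 L SU2 :=
  gaugeTransform (fun x => chartSU2 (z.1 x)) (orthoTube L (fun e₁ => chartSU2 (z.2.2 e₁.2)) z.2.1)

/-- The quaternion of a transformed link: `Q(ξ_x)·Q(w_e)·Q(c_k)·Q̄(ξ_y)`. [folklore] -/
def linkQuat (z : SliceParam L) (e : Edge 3 L) : ℍ :=
  quatChart (z.1 e.1) * quatChart (z.2.1 e) * quatChart (z.2.2 e.2) * star (quatChart (z.1 (e.1.shift e.2)))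

/-- The direction sum of the link quaternions. [folklore] -/
def meanQuat (z : SliceParam L) (k : Fin 3) : ℍ := ∑ x : Site 3 L, linkQuat L z (x, k)

/-- The quaternion model of the relative link: `‖M_k‖⁻¹ • (link · M̄_k)`. [folklore] -/
def relQuat (z : SliceParam L) (e : Edge 3 L) : ℍ := ‖meanQuat L z e.2‖⁻¹ • (linkQuat L z e * star (meanQuat L z e.2))

/-- The model of `relLinkVec ∘ actCfg` as an element of the link space. [folklore] -/
def sliceModel (z : SliceParam L) : LinkSpace L := WithLp.toLp 2 fun ea : Edge 3 L × Fin 3 => imVec (relQuat L z ea.1) ea.2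

omit [NeZero L] in
/-- The links of `actCfg z`, explicitly. [folklore] -/
theorem actCfg_apply (z : SliceParam L) (e : Edge 3 L) :
    actCfg L z e = chartSU2 (z.1 e.1) * (chartSU2 (z.2.1 e) * chartSU2 (z.2.2 e.2)) * (chartSU2 (z.1 (e.1.shift e.2)))⁻¹ := by
  simp [actCfg, gaugeTransform]

omit [NeZero L] in
/-- In the cap, the quaternion of a transformed link is `linkQuat`. [folklore] -/
theorem su2Quat_actCfg (z : SliceParam L) (hξ : ∀ x, ∑ a, z.1 x a ^ 2 ≤ 1) (hw : ∀ e, ∑ a, z.2.1 e a ^ 2 ≤ 1) (hc : ∀ k, ∑ a, z.2.2 k a ^ 2 ≤ 1)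
    (e : Edge 3 L) : su2Quat (actCfg L z e) = linkQuat L z e := by
  rw [actCfg_apply, su2Quat_mul, su2Quat_mul, su2Quat_mul, su2Quat_inv, su2Quat_chartSU2 (hξ _), su2Quat_chartSU2 (hw _),
    su2Quat_chartSU2 (hc _), su2Quat_chartSU2 (hξ _), linkQuat]
  simp only [mul_assoc]

/-- In the cap, the direction sum of `actCfg z` is `meanQuat`. [folklore] -/
theorem dirQuat_actCfg (z : SliceParam L) (hξ : ∀ x, ∑ a, z.1 x a ^ 2 ≤ 1) (hw : ∀ e, ∑ a, z.2.1 e a ^ 2 ≤ 1) (hc : ∀ k, ∑ a, z.2.2 k a ^ 2 ≤ 1)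
    (k : Fin 3) : dirQuat L k (actCfg L z) = meanQuat L z k := by
  rw [dirQuat_eq_sum_su2Quat, meanQuat]
  exact Finset.sum_congr rfl fun x _ => su2Quat_actCfg L z hξ hw hc (x, k)

/-- ★ **The quaternion model is exact** in the cap whenever the direction sums are nonzero: `relLinkVec(actCfg z) = sliceModel z`. [folklore] -/
theorem relLinkVec_actCfg_eq (z : SliceParam L) (hξ : ∀ x, ∑ a, z.1 x a ^ 2 ≤ 1) (hw : ∀ e, ∑ a, z.2.1 e a ^ 2 ≤ 1) (hc : ∀ k, ∑ a, z.2.2 k a ^ 2 ≤ 1)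
    (hM : ∀ k, meanQuat L z k ≠ 0) : relLinkVec L (actCfg L z) = sliceModel L z := by
  unfold relLinkVec sliceModel
  congr 1
  funext ea
  have hq : su2Quat (actCfg L z ea.1 * (polarMean L ea.1.2 (actCfg L z))⁻¹) = relQuat L z ea.1 := by
    have hD : dirQuat L ea.1.2 (actCfg L z) = meanQuat L z ea.1.2 := dirQuat_actCfg L z hξ hw hc ea.1.2
    have hD0 : dirQuat L ea.1.2 (actCfg L z) ≠ 0 := by rw [hD]; exact hM _
    rw [su2Quat_mul, su2Quat_inv, polarMean, su2Quat_quatToSU2 hD0, hD, su2Quat_actCfg L z hξ hw hc, Quaternion.star_smul,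
      mul_smul_comm, relQuat]
  rw [vecPart_eq_imVec, hq]

/-! ## §4 Smoothness of the model -/

section Smooth

variable {n : WithTop ℕ∞}

/-- Evaluation of the gauge parameter at a site is smooth (linear). [folklore] -/
theorem contDiff_evalSite (x : Site 3 L) : ContDiff ℝ n (fun z : SliceParam L => z.1 x) :=
  (contDiff_apply ℝ (Fin 3 → ℝ) x).comp contDiff_fst

/-- Evaluation of the stiff coordinate at a link is smooth (linear). [folklore] -/
theorem contDiff_evalEdge (e : Edge 3 L) : ContDiff ℝ n (fun z : SliceParam L => z.2.1 e) :=
  (contDiff_apply ℝ (Fin 3 → ℝ) e).comp (contDiff_fst.comp contDiff_snd)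

/-- Evaluation of the slow coordinate at a direction is smooth (linear). [folklore] -/
theorem contDiff_evalDir (k : Fin 3) : ContDiff ℝ n (fun z : SliceParam L => z.2.2 k) :=
  (contDiff_apply ℝ (Fin 3 → ℝ) k).comp (contDiff_snd.comp contDiff_snd)

/-- ★ The link quaternion is smooth where all chart arguments are in the open ball. [folklore] -/
theorem contDiffAt_linkQuat {z : SliceParam L} (hξ : ∀ x, ∑ a, z.1 x a ^ 2 < 1) (hw : ∀ e, ∑ a, z.2.1 e a ^ 2 < 1) (hc : ∀ k, ∑ a, z.2.2 k a ^ 2 < 1)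
    (e : Edge 3 L) : ContDiffAt ℝ n (fun z => linkQuat L z e) z := by
  have h1 : ContDiffAt ℝ n (fun z : SliceParam L => quatChart (z.1 e.1)) z := (contDiffAt_quatChart (hξ _)).comp z (contDiff_evalSite L e.1).contDiffAt
  have h2 : ContDiffAt ℝ n (fun z : SliceParam L => quatChart (z.2.1 e)) z := (contDiffAt_quatChart (hw _)).comp z (contDiff_evalEdge L e).contDiffAt
  have h3 : ContDiffAt ℝ n (fun z : SliceParam L => quatChart (z.2.2 e.2)) z := (contDiffAt_quatChart (hc _)).comp z (contDiff_evalDir L e.2).contDiffAt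
  have h4 : ContDiffAt ℝ n (fun z : SliceParam L => star (quatChart (z.1 (e.1.shift e.2)))) z :=
    contDiff_quatStar.contDiffAt.comp z ((contDiffAt_quatChart (hξ _)).comp z (contDiff_evalSite L (e.1.shift e.2)).contDiffAt)
  exact ((h1.mul h2).mul h3).mul h4

/-- ★ The direction sum is smooth there. [folklore] -/
theorem contDiffAt_meanQuat {z : SliceParam L} (hξ : ∀ x, ∑ a, z.1 x a ^ 2 < 1) (hw : ∀ e, ∑ a, z.2.1 e a ^ 2 < 1) (hc : ∀ k, ∑ a, z.2.2 k a ^ 2 < 1)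
    (k : Fin 3) : ContDiffAt ℝ n (fun z => meanQuat L z k) z := by
  unfold meanQuat
  exact ContDiffAt.sum fun x _ => contDiffAt_linkQuat L hξ hw hc (x, k)

/-- ★ The relative quaternion is smooth there, provided the direction sum is nonzero. [folklore] -/
theorem contDiffAt_relQuat {z : SliceParam L} (hξ : ∀ x, ∑ a, z.1 x a ^ 2 < 1) (hw : ∀ e, ∑ a, z.2.1 e a ^ 2 < 1) (hc : ∀ k, ∑ a, z.2.2 k a ^ 2 < 1)
    (hM : ∀ k, meanQuat L z k ≠ 0) (e : Edge 3 L) : ContDiffAt ℝ n (fun z => relQuat L z e) z := by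
  have hMe := contDiffAt_meanQuat L (n := n) hξ hw hc e.2
  have hinv : ContDiffAt ℝ n (fun z => ‖meanQuat L z e.2‖⁻¹) z := ((contDiffAt_norm ℝ (hM e.2)).comp z hMe).inv (norm_ne_zero_iff.mpr (hM e.2))
  have hstar : ContDiffAt ℝ n (fun z => star (meanQuat L z e.2)) z := contDiff_quatStar.contDiffAt.comp z hMe
  exact hinv.smul ((contDiffAt_linkQuat L hξ hw hc e).mul hstar)

/-- ★★ The model is smooth there. [folklore] -/
theorem contDiffAt_sliceModel {z : SliceParam L} (hξ : ∀ x, ∑ a, z.1 x a ^ 2 < 1) (hw : ∀ e, ∑ a, z.2.1 e a ^ 2 < 1) (hc : ∀ k, ∑ a, z.2.2 k a ^ 2 < 1)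
    (hM : ∀ k, meanQuat L z k ≠ 0) : ContDiffAt ℝ n (sliceModel L) z := by
  unfold sliceModel
  refine contDiffAt_piLp' (p := 2) fun ea => ?_
  exact (contDiff_imVec ea.2).contDiffAt.comp z (contDiffAt_relQuat L hξ hw hc hM ea.1)

end Smooth

/-! ## §5 ★★ Smoothness of `relLinkVec ∘ actCfg` at `0` -/

omit [NeZero L] in
/-- At `z = 0` every link quaternion is `1`. [folklore] -/
theorem linkQuat_zero (e : Edge 3 L) : linkQuat L 0 e = 1 := by
  have h0 : quatChart (0 : Fin 3 → ℝ) = 1 := by ext <;> simp [quatChart]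
  simp [linkQuat, h0]

/-- At `z = 0` the direction sum is `N ≠ 0`. [folklore] -/
theorem meanQuat_zero_ne (k : Fin 3) : meanQuat L 0 k ≠ 0 := by
  unfold meanQuat
  simp only [linkQuat_zero, Finset.sum_const, Finset.card_univ]
  rw [← Nat.cast_smul_eq_nsmul ℝ, smul_ne_zero_iff]
  exact ⟨by exact_mod_cast Fintype.card_ne_zero, one_ne_zero⟩

/-- Near `0` all chart arguments are in the open ball `|v|² < 1`. [folklore] -/
theorem eventually_charts_lt : ∀ᶠ z : SliceParam L in 𝓝 0,
    (∀ x, ∑ a, z.1 x a ^ 2 < 1) ∧ (∀ e, ∑ a, z.2.1 e a ^ 2 < 1) ∧ (∀ k, ∑ a, z.2.2 k a ^ 2 < 1) := by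
  have hball : Metric.ball (0 : SliceParam L) (1 / 2) ∈ 𝓝 (0 : SliceParam L) := Metric.ball_mem_nhds 0 (by norm_num)
  filter_upwards [hball] with z hz
  rw [Metric.mem_ball, dist_zero_right] at hz
  have hsq : ∀ v : Fin 3 → ℝ, ‖v‖ < 1 / 2 → ∑ a, v a ^ 2 < 1 := fun v hv => by
    have h3 := sum_sq_le_three_norm_sq v
    nlinarith [norm_nonneg v]
  have h1 : ‖z.1‖ < 1 / 2 := (norm_fst_le z).trans_lt hz
  have h2 : ‖z.2.1‖ < 1 / 2 := (norm_fst_le z.2).trans_lt ((norm_snd_le z).trans_lt hz)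
  have h3 : ‖z.2.2‖ < 1 / 2 := (norm_snd_le z.2).trans_lt ((norm_snd_le z).trans_lt hz)
  exact ⟨fun x => hsq _ ((norm_le_pi_norm z.1 x).trans_lt h1), fun e => hsq _ ((norm_le_pi_norm z.2.1 e).trans_lt h2),
    fun k => hsq _ ((norm_le_pi_norm z.2.2 k).trans_lt h3)⟩

/-- Near `0` every direction sum of the model is nonzero. [folklore] -/
theorem eventually_meanQuat_ne : ∀ᶠ z : SliceParam L in 𝓝 0, ∀ k, meanQuat L z k ≠ 0 := by
  refine Filter.eventually_all.mpr fun k => ?_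
  have hcont : ContinuousAt (fun z => meanQuat L z k) 0 := by
    obtain ⟨hξ, hw, hc⟩ := (eventually_charts_lt L).self_of_nhds
    exact (contDiffAt_meanQuat L (n := 0) hξ hw hc k).continuousAt
  exact hcont.eventually_ne (meanQuat_zero_ne L k)

/-- ★ **Near `0`, `relLinkVec ∘ actCfg` IS the smooth quaternion model.** [folklore] -/
theorem relLinkVec_actCfg_eventuallyEq : (fun z => relLinkVec L (actCfg L z)) =ᶠ[𝓝 (0 : SliceParam L)] sliceModel L := by
  filter_upwards [eventually_charts_lt L, eventually_meanQuat_ne L] with z hz hM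
  exact relLinkVec_actCfg_eq L z (fun x => (hz.1 x).le) (fun e => (hz.2.1 e).le) (fun k => (hz.2.2 k).le) hM

/-- ★★ **`z ↦ relLinkVec((orthoTube P(c) w)^{P∘ξ})` IS `C^n` AT `0`** for every `n`. [folklore] -/
theorem contDiffAt_relLinkVec_actCfg {n : WithTop ℕ∞} : ContDiffAt ℝ n (fun z => relLinkVec L (actCfg L z)) 0 := by
  obtain ⟨hξ, hw, hc⟩ := (eventually_charts_lt L).self_of_nhds
  exact (contDiffAt_sliceModel L hξ hw hc (eventually_meanQuat_ne L).self_of_nhds).congr_of_eventuallyEq (relLinkVec_actCfg_eventuallyEq L)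

/-- ★★ **Strict differentiability at `0`** (the hypothesis of the inverse-function step `…SliceImplicit`), with derivative `fderiv`; the sequel identifies it with
`(ξ', w', c') ↦ w' − ∇ξ'` from `…GaugeActionCovariant`. [folklore] -/
theorem hasStrictFDerivAt_relLinkVec_actCfg :
    HasStrictFDerivAt (fun z => relLinkVec L (actCfg L z)) (fderiv ℝ (fun z => relLinkVec L (actCfg L z)) 0) 0 :=
  (contDiffAt_relLinkVec_actCfg L (n := 1)).hasStrictFDerivAt one_ne_zero

/-- At `z = 0` the transformed tube point is the vacuum and its relative coordinate vanishes. [folklore] -/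
theorem relLinkVec_actCfg_zero : relLinkVec L (actCfg L 0) = 0 := by
  have h : relLinkVec L (actCfg L 0) = sliceModel L 0 := (relLinkVec_actCfg_eventuallyEq L).self_of_nhds
  rw [h]
  unfold sliceModel
  have hrel : ∀ e, relQuat L 0 e = 1 := fun e => by
    have hM : meanQuat L 0 e.2 = (Fintype.card (Site 3 L) : ℝ) • (1 : ℍ) := by
      unfold meanQuat; simp only [linkQuat_zero, Finset.sum_const, Finset.card_univ, Nat.cast_smul_eq_nsmul]
    have hN : (0 : ℝ) < Fintype.card (Site 3 L) := by exact_mod_cast Fintype.card_pos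
    rw [relQuat, linkQuat_zero, one_mul, hM, Quaternion.star_smul, star_one, norm_smul, norm_one, mul_one, Real.norm_of_nonneg hN.le,
      smul_smul, inv_mul_cancel₀ hN.ne', one_smul]
  simp only [hrel, imVec_one, Pi.zero_apply]
  rfl

end Summit.QuantumFields.YangMills.Theorems.FemtoTransferGap.TwoLattice.ConstTube

end
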